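import Summits.QuantumFields.YangMills.Theorems.UnitScaleTiltProp7Op137OfKernelRows
import HarnessLib

/-!
# Route `UnitScaleTilt`, crux K1 «MinimiserStabilityRegPr» (stmt-QuantumFields-19200), EX rows `norm_H₁` ∕ `norm_Hπ` (S47 ✓p766895), ★p1 g27 CENSUS #46 rows (2)(6) —
# **THE SUP ROW OF `K⁻¹ = (Q_kGQ_k†)⁻¹` FROM ITS KERNEL ROW (coarse → coarse Schur), SLOT-GENERIC** — the `hKinv` letter of px21 g15's ✓∕⧗`gradient_row_HT_of_gradient_row` (hence of
# `hGπ` and of this lineage's (H1∇)-E2E `norm_H₁` ∇-half) from the K-storey's DISPLAYED kernel row of `KinvT … Δx U₀` (px10's H-DOOR ✓p769611 binder text), `CK′ := 3·CK·(2(1+1∕δ))³`.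

Cell `ym3-torus` (HUMAN RULING D-0037; rung R3 = SU(2) YM₃ on T³ — NOT d = 4, NOT infinite volume, NOT a mass gap, NOT Clay).  Width seat `ym3-torus-px17` (gen 12).
THEOREMS ONLY (0 `def`, 0 `sorry`, default heartbeats); `--supports stmt-QuantumFields-19200 --as helper`; count-neutral.

WHAT IS PROVED (ns `Summit.QuantumFields.YangMills.Theorems.Prop7KinvSupRowOfKernelRow`).
* §1 ★ `sup_row_of_coarseCoarse_kernel_row` — the coarse → COARSE twin of ✓`Prop7Op137OfKernelRows.sup_row_of_coarse_kernel_row`: an additive `T` on the coarse one-forms with the pointwise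
  kernel bound `‖T(δ_y Z)(y′)‖ ≤ C·e^{−a·tdist(ŷ′, ŷ)}·‖Z‖` (`ŷ = siteShift y.src`) satisfies `‖(T Y)(y′)‖ ≤ 3C(2(1+1∕a))³·‖Y‖` (✓`sum_coarse_pbond_exp_neg_tdist_le`).
* §2 ★★ `supRow_KinvT_of_kernelRow` — at ANY Hessian slot `Δx`: the H-DOOR's `hKinv` kernel text (`CK`, rate `δ > 0`) ⟹ the `hKinv` SUP text of ✓∕⧗`gradient_row_HT_of_gradient_row`
  VERBATIM: `∀ b c, ‖toL2B⁻¹(KinvT … Δx U₀ (toL2B b)) c‖ ≤ (3·CK·(2(1+1∕δ))³)·‖b‖`.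
HYP-SAT (★★OWNER RULING №42): §1 is about an arbitrary additive `T`; §2's only letter is the displayed K-storey kernel row (suppliers: px10's (K2-KNIT) ✓p770187 §3 ∕ the cone PART A∕B ✓p774331 at
`Δ_πᴾ`, PART B′∕E4 at `Δ₁`); non-vacuous; no `Prop` placeholder.
HONEST SCOPE.  A row sum; nothing of the K-storey, `norm_H₁`, `norm_Hπ`, EX, 19200 or R3 is proved here; the Yang–Mills mass gap is NOT proved.

References: T. Bałaban, CMP **99** (1985) 389–434 [Balaban1985BackgroundPropagators] ((3.124)–(3.126) p.420, (3.133) p.422); CMP **102** (1985) 277–309 [Balaban1985Variational] ((137) p.298).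
-/

set_option autoImplicit false

noncomputable section

open scoped BigOperators Matrix.Norms.L2Operator InnerProductSpace ComplexConjugate

namespace Summit.QuantumFields.YangMills.Theorems.Prop7KinvSupRowOfKernelRow

open Literature.MathematicalPhysics.QuantumFieldTheory.Balaban1983to89
open Literature.MathematicalPhysics.QuantumFieldTheory.Balaban1983to89.T3ContinuumYM3Torus
open T3PrintedRegularOrbits (sites_eq)
open T3LevelShift (siteShift)
open B9Eq311L2Pairing (WL2)
open B11Eq103H1Complex (BondL2K)
open Summit.QuantumFields.YangMills.Theorems.Prop7SectET3Transport (periodsT3)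
open Summit.QuantumFields.YangMills.Theorems.Prop7SectET3HilbertLetters (W₂ toL2B)
open Summit.QuantumFields.YangMills.Theorems.Prop7SectET3CurvedPropagators (KinvT)
open Summit.QuantumFields.YangMills.Theorems.Prop7Op137OfKernelRows (sum_coarse_pbond_exp_neg_tdist_le)

variable (F : T3Family) (n K : ℕ) (h : n ≤ K)

/-! ## §1 The coarse → coarse Schur step -/

/-- ★ **THE COARSE → COARSE SCHUR STEP**: an additive map `T` on the coarse one-forms with the pointwise kernel bound `‖T(δ_y Z)(y′)‖ ≤ C·e^{−a·tdist(ŷ′, ŷ)}·‖Z‖` (`0 ≤ C`, `0 < a`,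
`ŷ = siteShift y.src` on the coarse torus of the fine member) satisfies `‖(T Y)(y′)‖ ≤ 3C(2(1+1∕a))³·‖Y‖` for every `Y` (sup norm) — the row sum over the coarse bonds
(✓`sum_coarse_pbond_exp_neg_tdist_le`). [cite: Balaban1985BackgroundPropagators, (3.133) p.422, (3.124)–(3.126) p.420; Balaban1985Variational, (137) p.298] -/
theorem sup_row_of_coarseCoarse_kernel_row (T : (PBond (F.P n) 0 → Matrix (Fin 2) (Fin 2) ℂ) →+ (PBond (F.P n) 0 → Matrix (Fin 2) (Fin 2) ℂ)) {C a : ℝ}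
    (hC : 0 ≤ C) (ha : 0 < a)
    (hT : ∀ (y : PBond (F.P n) 0) (Z : Matrix (Fin 2) (Fin 2) ℂ) (y' : PBond (F.P n) 0),
      ‖T (Pi.single y Z) y'‖ ≤ C * Real.exp (-(a * (Site.tdist (P := F.P K) (siteShift (sites_eq F n K h) y'.src) (siteShift (sites_eq F n K h) y.src) : ℝ))) * ‖Z‖)
    (Y : PBond (F.P n) 0 → Matrix (Fin 2) (Fin 2) ℂ) (y' : PBond (F.P n) 0) :
    ‖T Y y'‖ ≤ 3 * C * (2 * (1 + 1 / a)) ^ 3 * ‖Y‖ := by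
  classical
  have hX' : T Y y' = ∑ y : PBond (F.P n) 0, T (Pi.single y (Y y)) y' := by
    conv_lhs => rw [← Finset.univ_sum_single Y]
    rw [map_sum, Finset.sum_apply]
  rw [hX']
  refine (norm_sum_le _ _).trans ?_
  have hterm : ∀ y : PBond (F.P n) 0, ‖T (Pi.single y (Y y)) y'‖
      ≤ (C * ‖Y‖) * Real.exp (-(a * (Site.tdist (P := F.P K) (siteShift (sites_eq F n K h) y'.src) (siteShift (sites_eq F n K h) y.src) : ℝ))) := by
    intro y
    refine (hT y (Y y) y').trans ?_
    have h1 : C * Real.exp (-(a * (Site.tdist (P := F.P K) (siteShift (sites_eq F n K h) y'.src) (siteShift (sites_eq F n K h) y.src) : ℝ))) * ‖Y y‖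
        ≤ C * Real.exp (-(a * (Site.tdist (P := F.P K) (siteShift (sites_eq F n K h) y'.src) (siteShift (sites_eq F n K h) y.src) : ℝ))) * ‖Y‖ :=
      mul_le_mul_of_nonneg_left (norm_le_pi_norm Y y) (by positivity)
    linarith [h1]
  refine (Finset.sum_le_sum fun y _ => hterm y).trans ?_
  rw [← Finset.mul_sum]
  have hsum := sum_coarse_pbond_exp_neg_tdist_le F n K h (siteShift (sites_eq F n K h) y'.src) ha
  have hcoef : 0 ≤ C * ‖Y‖ := by positivity
  calc C * ‖Y‖ * ∑ y : PBond (F.P n) 0, Real.exp (-(a * (Site.tdist (P := F.P K) (siteShift (sites_eq F n K h) y'.src) (siteShift (sites_eq F n K h) y.src) : ℝ)))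
      ≤ C * ‖Y‖ * (3 * (2 * (1 + 1 / a)) ^ 3) := mul_le_mul_of_nonneg_left hsum hcoef
    _ = 3 * C * (2 * (1 + 1 / a)) ^ 3 * ‖Y‖ := by ring

/-! ## §2 ★★ The sup row of `K⁻¹` at any slot from its kernel row -/

variable (c₀ cB a : ℝ) [Fact (0 < c₀)] [Fact (0 < cB)]
  (Δx : GaugeField (F.P K) 0 (Matrix.specialUnitaryGroup (Fin 2) ℂ) → (BondL2K ℂ 3 (periodsT3 F K) c₀ W₂ →ₗ[ℂ] BondL2K ℂ 3 (periodsT3 F K) c₀ W₂))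

/-- ★★ **THE `hKinv` SUP ROW FROM THE `hKinv` KERNEL ROW, ANY SLOT `Δx`**: the H-DOOR ✓p769611's kernel text
`∀ y Z y′, ‖toL2B⁻¹(K⁻¹(toL2B(δ_y ⊗ Z)))(y′)‖ ≤ CK·e^{−δ·tdist(ŷ′, ŷ)}·‖Z‖` (`0 ≤ CK`, `0 < δ`) gives `∀ b c, ‖toL2B⁻¹(K⁻¹(toL2B b))(c)‖ ≤ (3·CK·(2(1+1∕δ))³)·‖b‖` — the `hKinv` letter of
✓∕⧗`Prop7GreenPiGradientRowOfLetters.gradient_row_HT_of_gradient_row` VERBATIM (§1 at `T := toL2B⁻¹ ∘ K⁻¹ ∘ toL2B`).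
[cite: Balaban1985BackgroundPropagators, (3.124)–(3.126) p.420, (3.133) p.422; Balaban1985Variational, (45) p.285, (137) p.298] -/
theorem supRow_KinvT_of_kernelRow (U₀ : GaugeField (F.P K) 0 (Matrix.specialUnitaryGroup (Fin 2) ℂ)) {CK δ : ℝ} (hCK : 0 ≤ CK) (hδ : 0 < δ)
    (hKinv : ∀ (y : PBond (F.P n) 0) (Z : Matrix (Fin 2) (Fin 2) ℂ) (y' : PBond (F.P n) 0),
      ‖(toL2B F n cB).symm (KinvT F n K h c₀ cB a Δx U₀ (toL2B F n cB (Pi.single y Z))) y'‖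
        ≤ CK * Real.exp (-(δ * (Site.tdist (P := F.P K) (siteShift (sites_eq F n K h) y'.src) (siteShift (sites_eq F n K h) y.src) : ℝ))) * ‖Z‖) :
    ∀ (b : PBond (F.P n) 0 → Matrix (Fin 2) (Fin 2) ℂ) (c : PBond (F.P n) 0),
      ‖(toL2B F n cB).symm (KinvT F n K h c₀ cB a Δx U₀ (toL2B F n cB b)) c‖ ≤ (3 * CK * (2 * (1 + 1 / δ)) ^ 3) * ‖b‖ := by
  intro b c
  -- the coarse → coarse additive map `T := toL2B⁻¹ ∘ K⁻¹ ∘ toL2B`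
  set T : (PBond (F.P n) 0 → Matrix (Fin 2) (Fin 2) ℂ) →+ (PBond (F.P n) 0 → Matrix (Fin 2) (Fin 2) ℂ) :=
    (((toL2B F n cB).symm.toLinearMap ∘ₗ KinvT F n K h c₀ cB a Δx U₀ ∘ₗ (toL2B F n cB).toLinearMap)).toAddMonoidHom with hTdef
  have hT : ∀ Y, T Y = (toL2B F n cB).symm (KinvT F n K h c₀ cB a Δx U₀ (toL2B F n cB Y)) := fun _ => rfl
  have hrow := sup_row_of_coarseCoarse_kernel_row F n K h T hCK hδ (fun y Z y' => by rw [hT]; exact hKinv y Z y') b c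
  rw [hT] at hrow
  exact hrow

end Summit.QuantumFields.YangMills.Theorems.Prop7KinvSupRowOfKernelRow

end
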